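import Summits.HubbardSuperconductivity.HubbardSuperconductivity.Theorems.WidthHaldaneDirichletBlockSums
import Summits.HubbardSuperconductivity.HubbardSuperconductivity.Theorems.WidthHaldaneTubeKineticWindow
import Literature.MathematicalPhysics.QuantumLattice.FreeFermionSectorEnergyDeviation
import Summits.HubbardSuperconductivity.HubbardSuperconductivity.Theorems.PerWidthThermodynamics.Negative.ZeroCouplingCompressibility

/-!
# The free kinetic number of the tube in closed form; the kinetic floor with an explicit constant

Support file for the tube cruxes stated over `WidthHaldaneDefs` (routes `WidthHaldane`,
`SeamInduction`; items stmt-HubbardSuperconductivity-16311/16312/18509/18510), all PROVED, no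
definitions, no named facts. `WidthHaldaneTubeKineticWindow.longKinetic_ge_of_window_free` bounds the
longitudinal kinetic form of every window state of the untwisted sector `(2n, 0)` by the FREE number
`2(Σ_{F_⊥} ε_⊥ - Σ_F ε_{L,M}) - Un - wM/L` (`F_⊥`, `F` Fermi sets of `n` momenta of the transverse band
`-2cos(2πb/M)` and of the full band). Here that number is bounded below in CLOSED FORM, uniformly usable
in the width (`S(m,N) = sin((2m+1)π/N)/sin(π/N)`, `WidthHaldaneDirichletBlockSums`):

* `sum_box_two_cos`, **`box_le_neg_sum_fermiSet_tubeBand`** — the Fermi sea beats a centred momentum BOX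
  `(2m₁+1) × (2m₂+1) ≤ n` padded by arbitrary momenta (bathtub `sum_fermiSet_le`):
  `-Σ_F ε_{L,M} ≥ (2m₂+1)2S(m₁,L) + (2m₁+1)2S(m₂,M) - 4(n - (2m₁+1)(2m₂+1))`;
* **`sum_transBand_ge`** — the transverse Fermi sum by DUALITY at the level `c = cos(2πm/M)`
  (`(2m-1)L ≤ n`): `Σ_{F_⊥} ε_⊥ ≥ -2L·S(m-1,M) - 2(n - (2m-1)L)` for ANY `n`-set `F_⊥`;
* `two_mul_freeNumber_ge` — the two together; **`kineticFloor_window_closedForm`** — plugged into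
  `kineticFloor_window_of_freeSums`: for `L, M ≥ 3`, `U ≥ 0`, `δ ≥ -1` and admissible `(m, m₁, m₂)`,
  every `k'` below the closed form minus `U·n + wM/L` is a kinetic floor `k'·LM ≤ K(ψ)` on the window of
  the sector `(N_{L,M}(δ), 0)` — the hypothesis `KineticFloorAt` of `stiffnessOfLandauCriterion` /
  `tubeStiffness_ge_of_landauWindow` with an explicit elementary constant.

Numerics of the closed form (best admissible `(m, m₁, m₂)`, `U = w = 0`, `δ = 0.2`): `k' = 0.210`
(`L = M = 100`), `0.232` (`200²`), `0.256` (`1000²`), `0.226` (`400 × 100`), `0.189` (`400 × 40`), `0.107`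
(`100 × 20`), negative at `60 × 12` — the box/duality losses are `O(1/L + 1/M)`, so the floor is
width-uniform for `M ≥ M₁` with `M₁` a few tens (the crux allows `∃ M₁`); the true free value is
`k_x ≈ 0.76`, the interaction costs `U(1-δ)/2` here (`0.4U` at `δ = 0.2`; sharp would be `U(1-δ)²/4`).
What remains of idea card `landau-window-yrast` after this is its ★ stub alone (the Landau criterion
on the window). [cite: ScalapinoWhiteZhang1993, §II]
-/

noncomputable section

namespace Summit.HubbardSuperconductivity.HubbardSuperconductivity.Theorems.WidthHaldane

set_option linter.dupNamespace false -- summit = problem name (single-conjunct summit), D-0017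

open scoped BigOperators Classical
open Literature.MathematicalPhysics.QuantumLattice

section FullBand

variable (L M : ℕ) [NeZero L] [NeZero M]

/-- **The box Fermi set pays its two Dirichlet sums**: over the product `A × B` of centred blocks of
sizes `2m₁+1 ≤ L` and `2m₂+1 ≤ M`,
`Σ_{(a,b) ∈ A×B} (2cos(2πa/L) + 2cos(2πb/M)) = (2m₂+1)·2S(m₁,L) + (2m₁+1)·2S(m₂,M)`,
`S(m,N) = sin((2m+1)π/N)/sin(π/N)`. [folklore] -/
theorem sum_box_two_cos (hL : 2 ≤ L) (hM : 2 ≤ M) (m₁ m₂ : ℕ) (h₁ : 2 * m₁ + 1 ≤ L) (h₂ : 2 * m₂ + 1 ≤ M) :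
    ∑ k ∈ ((Finset.range (2 * m₁ + 1)).image fun j : ℕ => ((j : ZMod L) - (m₁ : ZMod L))) ×ˢ ((Finset.range (2 * m₂ + 1)).image fun j : ℕ => ((j : ZMod M) - (m₂ : ZMod M))), (2 * Real.cos (2 * Real.pi * (k.1.val : ℝ) / L) + 2 * Real.cos (2 * Real.pi * (k.2.val : ℝ) / M)) =
      (2 * (m₂ : ℝ) + 1) * (2 * (Real.sin ((2 * (m₁ : ℝ) + 1) * Real.pi / L) / Real.sin (Real.pi / L))) +
        (2 * (m₁ : ℝ) + 1) * (2 * (Real.sin ((2 * (m₂ : ℝ) + 1) * Real.pi / M) / Real.sin (Real.pi / M))) := by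
  rw [Finset.sum_add_distrib, Finset.sum_product, Finset.sum_product]
  have hA := card_block (N := L) m₁ h₁
  have hB := card_block (N := M) m₂ h₂
  simp only [Finset.sum_const, nsmul_eq_mul, ← Finset.mul_sum]
  rw [hA, hB, sum_block_cos_eq (N := L) m₁ hL h₁, sum_block_cos_eq (N := M) m₂ hM h₂]
  push_cast
  ring

/-- **LOWER BOUND ON THE FREE KINETIC ENERGY OF THE TUBE BY A BOX FERMI SEA**: for every Fermi set `F`
of the free band `ε_{L,M}` with `(2m₁+1)(2m₂+1) ≤ #F ≤ LM` (`2m₁+1 ≤ L`, `2m₂+1 ≤ M`),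
`-Σ_F ε_{L,M} ≥ (2m₂+1)·2S(m₁,L) + (2m₁+1)·2S(m₂,M) - 4(#F - (2m₁+1)(2m₂+1))` — the Fermi sea beats the
box `A × B` padded by arbitrary momenta (bathtub `sum_fermiSet_le`; each padding level is `≤ 4`).
[folklore] -/
theorem box_le_neg_sum_fermiSet_tubeBand (hL : 2 ≤ L) (hM : 2 ≤ M) (F : Finset (ZMod L × ZMod M)) (μ : ℝ)
    (hF : ∀ k ∈ F, tubeBand L M k ≤ μ) (hF' : ∀ k ∉ F, μ ≤ tubeBand L M k)
    (m₁ m₂ : ℕ) (h₁ : 2 * m₁ + 1 ≤ L) (h₂ : 2 * m₂ + 1 ≤ M) (hp : (2 * m₁ + 1) * (2 * m₂ + 1) ≤ F.card)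
    (hn : F.card ≤ L * M) :
    (2 * (m₂ : ℝ) + 1) * (2 * (Real.sin ((2 * (m₁ : ℝ) + 1) * Real.pi / L) / Real.sin (Real.pi / L))) +
        (2 * (m₁ : ℝ) + 1) * (2 * (Real.sin ((2 * (m₂ : ℝ) + 1) * Real.pi / M) / Real.sin (Real.pi / M))) -
        4 * ((F.card : ℝ) - (2 * m₁ + 1) * (2 * m₂ + 1)) ≤
      -∑ k ∈ F, tubeBand L M k := by
  set P : Finset (ZMod L × ZMod M) := ((Finset.range (2 * m₁ + 1)).image fun j : ℕ => ((j : ZMod L) - (m₁ : ZMod L))) ×ˢ ((Finset.range (2 * m₂ + 1)).image fun j : ℕ => ((j : ZMod M) - (m₂ : ZMod M))) with hPdef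
  have hPcard : P.card = (2 * m₁ + 1) * (2 * m₂ + 1) := by
    rw [hPdef, Finset.card_product, card_block (N := L) m₁ h₁, card_block (N := M) m₂ h₂]
  -- pad the box to a set of `#F` momenta
  have huniv : (Finset.univ : Finset (ZMod L × ZMod M)).card = L * M := by
    rw [Finset.card_univ, Fintype.card_prod, ZMod.card, ZMod.card]
  obtain ⟨S, hPS, -, hScard⟩ := Finset.exists_subsuperset_card_eq (n := F.card) (Finset.subset_univ P)
    (by rw [hPcard]; exact hp) (by rw [huniv]; exact hn)
  -- the Fermi set beats `S`
  have hbath := sum_fermiSet_le (fun k => tubeBand L M k) (fun k => if k ∈ S then (1 : ℝ) else 0) F μ hF hF'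
    (fun k => by split_ifs <;> norm_num) (fun k => by split_ifs <;> norm_num)
    (by rw [Finset.sum_boole, Finset.filter_mem_eq_inter, Finset.univ_inter, hScard])
  have hS : ∑ k, tubeBand L M k * (if k ∈ S then (1 : ℝ) else 0) = ∑ k ∈ S, tubeBand L M k := by
    simp only [mul_ite, mul_one, mul_zero]
    rw [Finset.sum_ite_mem, Finset.univ_inter]
  rw [hS, ← Finset.sum_sdiff hPS] at hbath
  -- the box part is the Dirichlet expression, the padding part is at most `4` per level
  have hbox : ∑ k ∈ P, tubeBand L M k =
      -((2 * (m₂ : ℝ) + 1) * (2 * (Real.sin ((2 * (m₁ : ℝ) + 1) * Real.pi / L) / Real.sin (Real.pi / L))) +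
        (2 * (m₁ : ℝ) + 1) * (2 * (Real.sin ((2 * (m₂ : ℝ) + 1) * Real.pi / M) / Real.sin (Real.pi / M)))) := by
    rw [← sum_box_two_cos L M hL hM m₁ m₂ h₁ h₂, ← Finset.sum_neg_distrib]
    refine Finset.sum_congr rfl fun k _ => ?_
    rw [tubeBand]
    ring
  have hpad : ∑ k ∈ S \ P, tubeBand L M k ≤ 4 * ((F.card : ℝ) - (2 * m₁ + 1) * (2 * m₂ + 1)) := by
    have h4 : ∑ k ∈ S \ P, tubeBand L M k ≤ ∑ k ∈ S \ P, (4 : ℝ) :=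
      Finset.sum_le_sum fun k _ => PerWidthThermodynamics.Negative.tubeBand_le_four k
    rw [Finset.sum_const, nsmul_eq_mul, Finset.card_sdiff_of_subset hPS, hScard, hPcard] at h4
    have hc : (((F.card - (2 * m₁ + 1) * (2 * m₂ + 1) : ℕ)) : ℝ) = (F.card : ℝ) - (2 * m₁ + 1) * (2 * m₂ + 1) := by
      rw [Nat.cast_sub hp]
      push_cast
      ring
    rw [hc] at h4
    linarith
  linarith

end FullBand

section TransverseFloor

variable (L M : ℕ) [NeZero L] [NeZero M]

/-- **LOWER BOUND ON THE TRANSVERSE FERMI SUM BY DUALITY**: for every set `F_⊥` of `n` momenta of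
`ℤ/L × ℤ/M` and every `m ≥ 1` with `2m ≤ M`, `(2m-1)L ≤ n`,
`Σ_{F_⊥} (-2cos(2πb/M)) ≥ -2L·S(m-1,M) - 2(n - (2m-1)L)` (`S(m,N) = sin((2m+1)π/N)/sin(π/N)`): take the
dual level `c = cos(2πm/M)`; every level is `≥ -2c - (2cos - 2c)₊`, and the positive parts over the
whole torus sum to `L(2S(m-1,M) - (2m-1)2c)` (`sum_posPart_two_cos_sub_eq`). [folklore] -/
theorem sum_transBand_ge (Ft : Finset (ZMod L × ZMod M)) {m : ℕ} (hm1 : 1 ≤ m) (hm : 2 * m ≤ M)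
    (hn : (2 * m - 1) * L ≤ Ft.card) :
    -(2 * (L : ℝ) * (Real.sin ((2 * ((m - 1 : ℕ) : ℝ) + 1) * Real.pi / M) / Real.sin (Real.pi / M))) -
        2 * ((Ft.card : ℝ) - (2 * m - 1 : ℕ) * L) ≤
      ∑ k ∈ Ft, (-2 * Real.cos (2 * Real.pi * (k.2.val : ℝ) / M)) := by
  set c : ℝ := Real.cos (2 * Real.pi * (m : ℝ) / M) with hc
  have hc1 : c ≤ 1 := Real.cos_le_one _
  -- pointwise duality
  have hpt : ∀ k : ZMod L × ZMod M, -2 * c - max (2 * Real.cos (2 * Real.pi * (k.2.val : ℝ) / M) - 2 * c) 0 ≤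
      -2 * Real.cos (2 * Real.pi * (k.2.val : ℝ) / M) := by
    intro k
    rcases le_total (2 * Real.cos (2 * Real.pi * (k.2.val : ℝ) / M) - 2 * c) 0 with h | h
    · rw [max_eq_right h]; linarith
    · rw [max_eq_left h]; linarith
  have h1 : ∑ k ∈ Ft, (-2 * c - max (2 * Real.cos (2 * Real.pi * (k.2.val : ℝ) / M) - 2 * c) 0) ≤
      ∑ k ∈ Ft, (-2 * Real.cos (2 * Real.pi * (k.2.val : ℝ) / M)) := Finset.sum_le_sum fun k _ => hpt k
  rw [Finset.sum_sub_distrib, Finset.sum_const, nsmul_eq_mul] at h1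
  -- the positive parts over `Ft` are at most those over the whole torus, `= L · G`
  have h2 : ∑ k ∈ Ft, max (2 * Real.cos (2 * Real.pi * (k.2.val : ℝ) / M) - 2 * c) 0 ≤
      ∑ k : ZMod L × ZMod M, max (2 * Real.cos (2 * Real.pi * (k.2.val : ℝ) / M) - 2 * c) 0 :=
    Finset.sum_le_sum_of_subset_of_nonneg (Finset.subset_univ _) fun k _ _ => le_max_right _ _
  have h3 : ∑ k : ZMod L × ZMod M, max (2 * Real.cos (2 * Real.pi * (k.2.val : ℝ) / M) - 2 * c) 0 =
      (L : ℝ) * (2 * (Real.sin ((2 * ((m - 1 : ℕ) : ℝ) + 1) * Real.pi / M) / Real.sin (Real.pi / M)) -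
        (2 * ((m - 1 : ℕ) : ℝ) + 1) * (2 * c)) := by
    rw [Fintype.sum_prod_type]
    simp only [Finset.sum_const, Finset.card_univ, ZMod.card, nsmul_eq_mul]
    rw [sum_posPart_two_cos_sub_eq M hm1 hm]
  have hcast : ((2 * m - 1 : ℕ) : ℝ) = 2 * ((m - 1 : ℕ) : ℝ) + 1 := by
    rw [Nat.cast_sub (by omega), Nat.cast_sub hm1]; push_cast; ring
  have hn' : ((2 * m - 1 : ℕ) : ℝ) * L ≤ Ft.card := by exact_mod_cast hn
  rw [hcast] at hn' ⊢
  have hL0 : (0 : ℝ) ≤ L := by positivity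
  nlinarith [h1, h2, h3, mul_le_mul_of_nonneg_left hc1 (by nlinarith : (0 : ℝ) ≤ 2 * ((Ft.card : ℝ) - (2 * ((m - 1 : ℕ) : ℝ) + 1) * L))]

end TransverseFloor

section Assembly

variable (L M : ℕ) [NeZero L] [NeZero M]

/-- **THE FREE KINETIC NUMBER OF THE TUBE IN CLOSED FORM** (parametric): for Fermi sets `F_⊥`
(transverse band, any `n`-set in fact) and `F` (full band `ε_{L,M}`) of `n ≤ LM` momenta, a dual
transverse level `m` (`1 ≤ m`, `2m ≤ M`, `(2m-1)L ≤ n`) and a box `(2m₁+1) × (2m₂+1) ≤ n`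
(`2m₁+1 ≤ L`, `2m₂+1 ≤ M`), with `S(m,N) = sin((2m+1)π/N)/sin(π/N)`:
`2(Σ_{F_⊥} ε_⊥ - Σ_F ε_{L,M}) ≥ 2[(2m₂+1)2S(m₁,L) + (2m₁+1)2S(m₂,M) - 4(n - (2m₁+1)(2m₂+1))] - 2[2L·S(m-1,M) + 2(n - (2m-1)L)]`.
[folklore] -/
theorem two_mul_freeNumber_ge (hL : 2 ≤ L) (hM : 2 ≤ M) (Ft F : Finset (ZMod L × ZMod M)) (μ : ℝ)
    (hF : ∀ k ∈ F, tubeBand L M k ≤ μ) (hF' : ∀ k ∉ F, μ ≤ tubeBand L M k)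
    {n : ℕ} (hcardt : Ft.card = n) (hcard : F.card = n) (hnLM : n ≤ L * M)
    {m m₁ m₂ : ℕ} (hm1 : 1 ≤ m) (hm : 2 * m ≤ M) (hmn : (2 * m - 1) * L ≤ n)
    (h₁ : 2 * m₁ + 1 ≤ L) (h₂ : 2 * m₂ + 1 ≤ M) (hp : (2 * m₁ + 1) * (2 * m₂ + 1) ≤ n) :
    2 * ((2 * (m₂ : ℝ) + 1) * (2 * (Real.sin ((2 * (m₁ : ℝ) + 1) * Real.pi / L) / Real.sin (Real.pi / L))) +
          (2 * (m₁ : ℝ) + 1) * (2 * (Real.sin ((2 * (m₂ : ℝ) + 1) * Real.pi / M) / Real.sin (Real.pi / M))) -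
          4 * ((n : ℝ) - (2 * m₁ + 1) * (2 * m₂ + 1))) -
        2 * (2 * (L : ℝ) * (Real.sin ((2 * ((m - 1 : ℕ) : ℝ) + 1) * Real.pi / M) / Real.sin (Real.pi / M)) +
          2 * ((n : ℝ) - (2 * m - 1 : ℕ) * L)) ≤
      2 * ((∑ k ∈ Ft, -2 * Real.cos (2 * Real.pi * (k.2.val : ℝ) / M)) - ∑ k ∈ F, tubeBand L M k) := by
  have ht := sum_transBand_ge L M Ft hm1 hm (by rw [hcardt]; exact hmn)
  have hb := box_le_neg_sum_fermiSet_tubeBand L M hL hM F μ hF hF' m₁ m₂ h₁ h₂ (by rw [hcard]; exact hp)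
    (by rw [hcard]; exact hnLM)
  rw [hcardt] at ht
  rw [hcard] at hb
  linarith

end Assembly

section KineticFloorClosedForm

variable (L M : ℕ) [NeZero L] [NeZero M] (Λ : Type) [LinearOrder Λ] [Fintype Λ]
  (e : Λ ≃ ZMod L × ZMod M)

open Matrix

/-- **KINETIC FLOOR ON THE WINDOW IN CLOSED FORM** (`L, M ≥ 3`, `U ≥ 0`, `δ ≥ -1`; `n = N_{L,M}(δ)/2`):
with Fermi sets `F_⊥`, `F` of `n` momenta, a dual level `m` and a box `(2m₁+1) × (2m₂+1)` as in
`two_mul_freeNumber_ge`, every `k'` with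
`k'·LM ≤ 2[(2m₂+1)2S(m₁,L) + (2m₁+1)2S(m₂,M) - 4(n - (2m₁+1)(2m₂+1))] - 2[2L·S(m-1,M) + 2(n - (2m-1)L)] - U·n - wM/L`
is a kinetic floor on the window: `k'·LM ≤ K(ψ)` for every unit vector `ψ` of the sector
`(N_{L,M}(δ), 0)` with `Re⟨ψ,H₀ψ⟩ - E(0) ≤ wM/L` — the hypothesis `KineticFloorAt` of the Landau
reductions (`stiffnessOfLandauCriterion`, `tubeStiffness_ge_of_landauWindow`) with an EXPLICIT
elementary constant (choose `m₁/L ≈ m₂/M ≈ √((1-δ)/8)`, `(2m-1)L ≈ n`: `k' → (8/π)√((1-δ)/8)·2sin(2π√((1-δ)/8))… ≈ 0.26 - 0.4U`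
at `δ = 0.2` as `L, M → ∞`). [cite: ScalapinoWhiteZhang1993, §II] -/
theorem kineticFloor_window_closedForm (hL : 3 ≤ L) (hM : 3 ≤ M) (U : ℝ) (hU : 0 ≤ U) {δ : ℝ}
    (hδ : -1 ≤ δ) (Ft F : Finset (ZMod L × ZMod M)) (μt μ : ℝ)
    (hFt : ∀ k ∈ Ft, -2 * Real.cos (2 * Real.pi * (k.2.val : ℝ) / M) ≤ μt)
    (hFt' : ∀ k ∉ Ft, μt ≤ -2 * Real.cos (2 * Real.pi * (k.2.val : ℝ) / M))
    (hF : ∀ k ∈ F, tubeBand L M k ≤ μ) (hF' : ∀ k ∉ F, μ ≤ tubeBand L M k)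
    (hcardt : Ft.card = ⌊(1 - δ) * ((L : ℝ) * (M : ℝ)) / 2⌋₊) (hcard : F.card = ⌊(1 - δ) * ((L : ℝ) * (M : ℝ)) / 2⌋₊)
    {m m₁ m₂ : ℕ} (hm1 : 1 ≤ m) (hm : 2 * m ≤ M) (hmn : (2 * m - 1) * L ≤ ⌊(1 - δ) * ((L : ℝ) * (M : ℝ)) / 2⌋₊)
    (h₁ : 2 * m₁ + 1 ≤ L) (h₂ : 2 * m₂ + 1 ≤ M)
    (hp : (2 * m₁ + 1) * (2 * m₂ + 1) ≤ ⌊(1 - δ) * ((L : ℝ) * (M : ℝ)) / 2⌋₊)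
    (w k' : ℝ)
    (hk' : k' * ((L : ℝ) * M) ≤
      2 * ((2 * (m₂ : ℝ) + 1) * (2 * (Real.sin ((2 * (m₁ : ℝ) + 1) * Real.pi / L) / Real.sin (Real.pi / L))) +
          (2 * (m₁ : ℝ) + 1) * (2 * (Real.sin ((2 * (m₂ : ℝ) + 1) * Real.pi / M) / Real.sin (Real.pi / M))) -
          4 * ((⌊(1 - δ) * ((L : ℝ) * (M : ℝ)) / 2⌋₊ : ℝ) - (2 * m₁ + 1) * (2 * m₂ + 1))) -
        2 * (2 * (L : ℝ) * (Real.sin ((2 * ((m - 1 : ℕ) : ℝ) + 1) * Real.pi / M) / Real.sin (Real.pi / M)) +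
          2 * ((⌊(1 - δ) * ((L : ℝ) * (M : ℝ)) / 2⌋₊ : ℝ) - (2 * m - 1 : ℕ) * L)) -
        U * ⌊(1 - δ) * ((L : ℝ) * (M : ℝ)) / 2⌋₊ - w * M / L) :
    ∀ ψ ∈ szSector (Λ := Λ) (tubeFilling L M δ) 0, star ψ ⬝ᵥ ψ = (1 : ℂ) →
      (expect (tubeH0 L M Λ e U) ψ).re - tubeEnergy L M Λ e U 0 (tubeFilling L M δ) ≤ w * M / L →
        k' * ((L : ℝ) * M) ≤ (∑ a : ZMod L, ∑ b : ZMod M, ∑ σ : Fin 2,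
          (expect (creation (orb (e.symm (a, b)) σ) * annihilation (orb (e.symm (a - 1, b)) σ) +
            creation (orb (e.symm (a - 1, b)) σ) * annihilation (orb (e.symm (a, b)) σ)) ψ).re) := by
  have hn : ⌊(1 - δ) * ((L : ℝ) * (M : ℝ)) / 2⌋₊ ≤ L * M := half_tubeFilling_le L M hδ
  have hfree := two_mul_freeNumber_ge L M (by omega) (by omega) Ft F μ hF hF' hcardt hcard hn hm1 hm hmn h₁ h₂ hp
  exact kineticFloor_window_of_freeSums L M Λ e hL hM U hU hδ Ft F μt μ hFt hFt' hF hF' hcardt hcard w k'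
    (by linarith)

end KineticFloorClosedForm
end Summit.HubbardSuperconductivity.HubbardSuperconductivity.Theorems.WidthHaldane

end
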